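/-
Copyright: lit-balaban Phase-2 proof seat p30 (gen 6).  Statement-level skeleton of a published paper; no proof claims beyond what
the kernel checks below.
-/
import Literature.MathematicalPhysics.QuantumFieldTheory.BalabanImbrieJaffe1984to88.BIJ85Rem317AnyField

/-!
# `BalabanImbrieJaffe1984to88.BIJ85Eq631SmallField` — T. Bałaban, J. Imbrie, A. Jaffe, *Renormalization of the Higgs model: minimizers,
propagators and the stability of mean field theory*, Commun. Math. Phys. **97** (1985) 299–329 [BalabanImbrieJaffe1985]: Sect. 6.2
**(6.3.1) = (6.2.5)–(6.2.6) ON THE TORI, AS PRINTED, IN THE SMALL-FIELD REGION** — the last hypothesis of seat p30's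
`BIJ85Eq622Torus.eq631_explicit`, the small-field decomposition (6.4) of the plaquette field `f^{(k)}(p) = (ie_k)^{−1} ln u(∂p)` ((6.3)),
is DISCHARGED by seat p31's torus theorem `BIJ85Eq454Holonomy.eq64` in the printed small-field region (*"(6.4) … is valid as long as
u′(p) and (Q^{s*}_kv)(p) are close to 1 … In this paper we are concerned with the small field regions which give the dominant contributions
to the integral. In this region the identity (6.4) holds"*, p. 318): with `u = u′Q^{s*}v`, `u′ = exp(ie_kB′)` ((6.2)), `f^{(k)} = (ie_k)^{−1}
ln u(∂·)` ((6.3)), `f^{(k+1)} = (ie_{k+1})^{−1} ln v(∂·)` ((4.2.4) at k+1, `e_{k+1} = L^{(4−d)/2}e_k`), `u_k`, `u_{k+1}` by (4.5.4) and `B` by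
(6.1.8), the decomposition `u_k = u_{k+1}e^{ie_kηH_kB}e^{iη∂ω}` holds for EVERY L-lattice U(1) field `v` and every unit-lattice `B′`
satisfying only the three printed smallness conditions (`|arg u′(∂p)| < π/2`, `|arg (Q^{s*}v)(∂p)| < π/2`, `|e_k(∂B′)(p)| < π` for all p)

statement-level skeleton of published theorems with citation tags; proofs where landed; nothing here is a claim about the Yang–Mills mass gap

PDF held: `paper:balaban1985-cmp97-bij-higgs-minimizers` (journal page = PDF page + 298).  Pages read as images: pp. 318–320 [PDF 20–22]
(`HOME/lit-balaban-r15/pages/1985-cmp97-bij-higgs-minimizers-p020,p021,p022-x2.png`).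

CITATION HEADER (lean-in-tree rule).  Part of the lit-balaban TYPED SKELETON (HOME `run/shared/lean/pub/lit-balaban/`), Phase-2
seat p30 (gen 6), unit `lit-balaban-p30`; WHAT IS REPRODUCED = rows **C1.Eq6.2.1-6.2.6**, **C1.Eq6.3.1-6.3.4** (member (6.3.1)) and
**C1.Eq6.1-6.4** (members (6.2)–(6.4), consumed) of `HOME/SKELETON.md` (reader file `HOME/lit-balaban-r15/ROWS-C1.md`) AT THE TORUS MODEL
OF RECORD (kind «model-instance»).

THE PRINTED TEXT (p. 318 [PDF 20], verbatim): *"Let v denote the average gauge field on the L-lattice, and on the unit lattice let u =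
u′Q^{s*}v, u′ = exp(ie_kB′). (6.2) The plaquette field f^{(k)}(p) = (ie_k)^{−1} ln u(∂p), p ∈ T₁, (6.3) then decomposes as f^{(k)}(p) =
(ie_k)^{−1} ln u′(∂p) + (ie_k)^{−1} ln(Q^{s*}v)(∂p) = (∂B′)(p) + L^{−d/2}(Q^{e*}f^{(k+1)})(p), (6.4) which is valid as long as u′(p) and
(Q^{s*}_kv)(p) are close to 1."*; p. 320 [PDF 22]: *"u_k = u_{k+1}e^{ie_kηH_kB}e^{iη∂ω}, (6.3.1) where ω denotes the gauge transformation
(6.2.6)."*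

THE TYPING (objects of `BIJ85Eq622Torus` / `BIJ85Eq625Torus`): unit lattice `T^{(k)}` with curl factor `c = L^k` (= `η⁻¹`, so that the
unit-lattice curl `dOne P k c` of (6.4) is the plain plaquette sum `curl1`, `dOne_Lk_apply`), `ηL^k = 1`, weight `w > 0`; `l = L^{−d/2}`,
`e′ = e_{k+1} = L^{(4−d)/2}e_k` (p31's `eEps_mul`); `Q^{s*}v = qsU1 v`, `Q^{s*}_k = qsU1Iter k`, `Q^{e*} = QesOne` (one step, (2.22)),
`Q^{e*}_j = QesOp hd w j`; `E = expField (e*η) ∘ ofLp`; `H_k = HkE` (Landau), `C^{(k)} = CE`, `𝒟 = DkE`, `D = D527E`, `λ_k = lamE`.  WHAT IS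
PROVED: `expField_Qsstar_bondPotential` (the Lie-algebra form of `Q^{s*}v` for an arbitrary `v`, (4.5.1)–(4.5.2)), `dOne_Lk_apply`, **`eq64_torus`**
((6.4) as the vector identity `f^{(k)} = ∂B′ + lQ^{e*}f^{(k+1)}` in `UnitPlaqSpace P k` — the hypothesis `h64` of `eq625_torus`/`eq631_explicit` —
from p31's componentwise `eq64`, for every `v`), **`eq631_smallField`** ((6.3.1) on the tori with no hypothesis beyond the three printed smallness
conditions).  D-0026: theorems only, no `def`, no new named fact.  Unit `lit-balaban-p30` (literature-prover-lit-balaban-p30-g6-0), 2026-08-21.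
-/

open scoped BigOperators RealInnerProductSpace

namespace Literature.MathematicalPhysics.QuantumFieldTheory.BalabanImbrieJaffe1984to88.BIJ85Eq631SmallField

open Literature.MathematicalPhysics.QuantumFieldTheory.Balaban1983to89
open LatticeFieldCalculus BIJ85Sect1Model BIJ85SmallFieldSplit64 BIJ85AxialPropagator411 BIJ85SigmaForm421 BIJ85UnitPropagator433
  BIJ85Prop521Proof BIJ85Prop521Torus BIJ85Sigma421Torus BIJ85Eq611Torus BIJ85LandauMinimizer442V1 BIJ85Prop511Torus
  BIJ85Prop522Torus BIJ85Eq219Proof BIJ85CurlQsstar BIJ85Eq531Inputs BIJ85Eq453GaugeField BIJ85Eq454Holonomy BIJ85Eq625Torus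
  BIJ85Eq622Torus BIJ85Rem317AnyField

noncomputable section

variable {P : Params}

/-! ## 1. The objects of (6.2)–(6.4) on the Euclidean carriers -/

/-- **(4.5.1)–(4.5.2) for an arbitrary L-lattice field `v`**, one step: `Q^{s*}v` (the group-valued (4.5.3), `qsU1 v`) IS `exp(ie_kη₁(Q^{s*}B))`
with `B = (ie_k)^{−1} ln v` ((4.5.1)) and `η₁L = 1` (p31's dictionary `expField_Qsstar_eq_qsstarG` + `expField_bondPotential`; `k + 1 ≤ m + K`,
`e ≠ 0`). [cite: BalabanImbrieJaffe1985, (4.5.2) p.312] -/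
theorem expField_Qsstar_bondPotential {k : ℕ} (hk : k + 1 ≤ P.m + P.K) {e : ℝ} (he : e ≠ 0) (v : U1Field P (k + 1)) :
    expField (e * (P.L : ℝ)⁻¹) ((torusBlockBonds P k).Qsstar (bondPotential e v)) = qsU1 v := by
  have hL : (P.L : ℝ) ≠ 0 := by have := P.hL.2; positivity
  funext b
  rw [expField_Qsstar_eq_qsstarG hk e (P.L : ℝ)⁻¹ (inv_mul_cancel₀ hL) (bondPotential e v) b, expField_bondPotential e he v]

/-- With the curl factor `c = L^k` (`= η⁻¹`) the unit-lattice curl `dOne P k c` of `BIJ85Eq611Torus` is the plain plaquette sum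
`(∂B′)(p) = B′(∂p)` of (6.4) (`BIJ85SmallFieldSplit64.curl1`). [cite: BalabanImbrieJaffe1985, (6.4) p.318] -/
theorem dOne_Lk_apply (k : ℕ) (B' : CoarseSpace P k) (p : Plaq P k) :
    dOne P k ((P.L : ℝ) ^ k) B' p = curl1 (WithLp.ofLp B') p := by
  have hL : (P.L : ℝ) ^ k ≠ 0 := by have := P.hL.2; positivity
  rw [dOne_apply, div_self hL, curl_one_eq_curl1]

/-! ## 2. (6.4) as the vector identity `h64` -/

/-- **(6.4) ON THE TORI as the identity `f^{(k)} = ∂B′ + lQ^{e*}f^{(k+1)}` of unit-lattice plaquette fields** (the hypothesis `h64` of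
`BIJ85Eq625Torus.eq625_torus` / `BIJ85Eq622Torus.eq631_explicit`): for EVERY L-lattice U(1) field `v` and unit-lattice `B′`, with `u =
u′Q^{s*}v`, `u′ = exp(ie_kB′)` ((6.2)), `f^{(k)} = (ie_k)^{−1} ln u(∂·)` ((6.3)), `f^{(k+1)} = (ie_{k+1})^{−1} ln v(∂·)`, `e_{k+1} = L^{(4−d)/2}e_k`,
`l = L^{−d/2}`, curl factor `c = L^k`, IN THE PRINTED SMALL-FIELD REGION `|arg u′(∂p)| < π/2`, `|arg (Q^{s*}v)(∂p)| < π/2` (additivity of the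
branch (2.11)) and `|e_k(∂B′)(p)| < π` (no winding) — componentwise seat p31's `BIJ85Eq454Holonomy.eq64` at `B = (ie_k)^{−1} ln v`; `k + 1 ≤
m + K`, `2 ≤ d`, `e_k ≠ 0`. [cite: BalabanImbrieJaffe1985, (6.4) p.318] -/
theorem eq64_torus (hd : 2 ≤ P.d) {k : ℕ} (hk : k + 1 ≤ P.m + P.K) {e : ℝ} (he : e ≠ 0) (v : U1Field P (k + 1))
    (B' : CoarseSpace P k)
    (hu : ∀ p : Plaq P k, |Complex.arg ((plaq (expField e (WithLp.ofLp B')) p : Circle) : ℂ)| < Real.pi / 2)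
    (hqv : ∀ p : Plaq P k, |Complex.arg ((plaq (qsU1 v) p : Circle) : ℂ)| < Real.pi / 2)
    (hsmall : ∀ p : Plaq P k, |e * curl1 (WithLp.ofLp B') p| < Real.pi) :
    toU P k (plaqField e (translate62 (expField e (WithLp.ofLp B')) (qsU1 v))) =
      dOne P k ((P.L : ℝ) ^ k) B'
        + (P.L : ℝ) ^ (-(P.d : ℝ) / 2) • QesOne P hd k (toU P (k + 1) (plaqField ((P.L : ℝ) ^ ((4 - (P.d : ℝ)) / 2) * e) v)) := by
  have hL : (P.L : ℝ) ≠ 0 := by have := P.hL.2; positivity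
  have hdict := expField_Qsstar_bondPotential hk he v
  refine PiLp.ext fun p => ?_
  rw [PiLp.add_apply, PiLp.smul_apply, smul_eq_mul, dOne_Lk_apply, QesOne_apply]
  have hw' : |Complex.arg ((plaq (expField (e * (P.L : ℝ)⁻¹) ((torusBlockBonds P k).Qsstar (bondPotential e v))) p : Circle) : ℂ)|
      < Real.pi / 2 := by
    rw [hdict]; exact hqv p
  have h := eq64 hk hd he (P.L : ℝ)⁻¹ (inv_mul_cancel₀ hL) (WithLp.ofLp B') (bondPotential e v) p (hu p) hw' (hsmall p)
  rw [hdict, expField_bondPotential e he v] at h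
  exact h

/-! ## 3. (6.3.1) in the small-field region -/

/-- **(6.3.1) = (6.2.5)–(6.2.6) ON THE TORI, AS PRINTED, IN THE SMALL-FIELD REGION** p. 320 [PDF 22]: *"u_k = u_{k+1}e^{ie_kηH_kB}e^{iη∂ω},
(6.3.1) where ω denotes the gauge transformation (6.2.6)"* — for EVERY U(1) field `v` on the L-lattice `T^{(k+1)}` and every Lie-algebra field
`B′` on the unit lattice `T^{(k)}` in the printed small-field region (`hu`, `hqv`, `hsmall`, all plaquettes), with: `u := u′Q^{s*}v`, `u′ =
exp(ie_kB′)` ((6.2)); `f^{(k)} := (ie_k)^{−1} ln u(∂·)` ((6.3)); `f^{(k+1)} := (ie_{k+1})^{−1} ln v(∂·)`, `e_{k+1} = L^{(4−d)/2}e_k` ((4.2.4)); `u_k :=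
(Q^{s*}_ku)·E(−𝒟_k∂^*Q^{e*}_kf^{(k)})` ((4.5.4) = (6.2.1)); `u_{k+1} := (Q^{s*}_{k+1}v)·E(−l𝒟_{k+1}∂^*Q^{e*}_{k+1}f^{(k+1)})` ((4.5.4) at k+1 before
rescaling, `l = L^{−d/2}`, T4); `B := B′ + lC^{(k)}H_k^*∂^*Q^{e*}_{k+1}f^{(k+1)}` ((6.1.8)); `ω = D(Q^{e*}_k∂B′) + λ_k(H_kB) − lλ_k(H_kC^{(k)}H_k^*∂^*
Q^{e*}_{k+1}f^{(k+1)})` ((6.2.6)); `E = exp(ie_kη ·)`, `ηL^k = 1`; curl factor `c = L^k`, weight `w > 0`; Landau `H_k = HkE`, `C^{(k)} = CE`, `𝒟 =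
DkE`, `D = D527E`, `λ_k = lamE` — seat p30's `BIJ85Eq622Torus.eq631_explicit` with its last hypothesis (6.4) supplied by `eq64_torus`.  Standing
range `k + 1 ≤ m + K`, `2 ≤ d`, `e_k ≠ 0`. [cite: BalabanImbrieJaffe1985, (6.3.1) p.320] -/
theorem eq631_smallField (hd : 2 ≤ P.d) {k : ℕ} (hk : k + 1 ≤ P.m + P.K) {w : ℝ} (hw : 0 < w) {e : ℝ} (he : e ≠ 0) (η : ℝ)
    (hη : η * (P.L : ℝ) ^ k = 1) (v : U1Field P (k + 1)) (B' : CoarseSpace P k)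
    (hu : ∀ p : Plaq P k, |Complex.arg ((plaq (expField e (WithLp.ofLp B')) p : Circle) : ℂ)| < Real.pi / 2)
    (hqv : ∀ p : Plaq P k, |Complex.arg ((plaq (qsU1 v) p : Circle) : ℂ)| < Real.pi / 2)
    (hsmall : ∀ p : Plaq P k, |e * curl1 (WithLp.ofLp B') p| < Real.pi) :
    let c : ℝ := (P.L : ℝ) ^ k
    let l : ℝ := (P.L : ℝ) ^ (-(P.d : ℝ) / 2)
    let u : U1Field P k := translate62 (expField e (WithLp.ofLp B')) (qsU1 v)
    let fk : UnitPlaqSpace P k := toU P k (plaqField e u)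
    let fL : UnitPlaqSpace P (k + 1) := toU P (k + 1) (plaqField ((P.L : ℝ) ^ ((4 - (P.d : ℝ)) / 2) * e) v)
    let uk : U1Field P 0 := qsU1Iter k u * expField (e * η) (WithLp.ofLp
      (-(DkE P w c k (LinearMap.adjoint (curlOp (P := P) w c) (QesOp (P := P) hd w k fk)))))
    let uk1 : U1Field P 0 := qsU1Iter (k + 1) v * expField (e * η) (WithLp.ofLp
      (-(l • DkE P w c (k + 1) (LinearMap.adjoint (curlOp (P := P) w c) (QesOp (P := P) hd w (k + 1) fL)))))
    let B : CoarseSpace P k := B' + l • CE P w c k (LinearMap.adjoint (HkE P w c k)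
      (LinearMap.adjoint (curlOp (P := P) w c) (QesOp (P := P) hd w (k + 1) fL)))
    let ω : EuclideanSpace ℝ (Balaban1983to89.Site P 0) :=
      D527E P w c k (QesOp (P := P) hd w k (dOne P k c B')) + lamE P c k (HkE P w c k B)
        - l • lamE P c k (HkE P w c k (CE P w c k (LinearMap.adjoint (HkE P w c k)
            (LinearMap.adjoint (curlOp (P := P) w c) (QesOp (P := P) hd w (k + 1) fL)))))
    uk = uk1 * expField (e * η) (WithLp.ofLp (HkE P w c k B)) * expField (e * η) (WithLp.ofLp (gradV1 P c ω)) := by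
  intro c l u fk fL uk uk1 B ω
  have hc : c ≠ 0 := by
    have := P.hL.2
    show (P.L : ℝ) ^ k ≠ 0
    positivity
  exact eq631_explicit hd hk hc hw e η l hη v B' fk fL (eq64_torus hd hk he v B' hu hqv hsmall)

end

end Literature.MathematicalPhysics.QuantumFieldTheory.BalabanImbrieJaffe1984to88.BIJ85Eq631SmallField
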